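import Summits.QuantumFields.BalabanUV.T4Continuum.Support.T4TrajectoryDensityFreshEnvelope

/-!
# `T4Continuum.T4TrajectoryDensityFreshBooking` — the envelope response of a regenerating family READ OFF THE BOOKING'S OWN
# ENVELOPE BY NAME (`T4TrajectoryComparison.Trajectory.envVar` / `EnvBoundAtVar` with the transport rate `ψ·α`): the last
# scalar link of the (w2-obs) reduction (cell `pub-balaban`, sub-cell `t4`, spine estimate NE1′ (node O3b/H2), lineage t4-ne1p-p1 =
# PROVER seat P1 «RG-trajectory comparison», generation 22; tree target `Summits/QuantumFields/BalabanUV/T4Continuum/Support/`;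
# ADDITIVE — imports `T4TrajectoryDensityFreshEnvelope` ONLY; uses `T4TrajectoryComparison`'s definitions by name, modifies nothing)

HONEST FRAMING.  Finite four-torus, rung (B)+1 only — NOT infinite volume, NOT a mass gap, NOT the Clay problem, NOT summit
progress.  «continuum YM on T⁴ ⇐ BetaPertH ∧ nine spine estimates (0/9 proved); BetaPertH ⇐ (D1) ∧ (D4) ∧ CAP+tail; G-an2-4
gates asym, D1 and NE2/3/4».  [folklore] real-number bookkeeping over the booking vocabulary of `T4TrajectoryComparison`
(`Booking`, `Trajectory`, `stepProd`, `envVar`, `EnvBoundAtVar`), 0 sorry, 0 citations; nothing of Bałaban's densities or the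
cell's D-terms is asserted — the envelope bound is the booking induction's OUTPUT shape, taken here as a hypothesis per scale.

CONTENTS (§17 of the (w2)-split).  `T4TrajectoryDensityFreshEnvelope` left ONE typed item: feed its shape `EnvelopeResponse` (per
live family, under the budget history, fresh response `≤ R̂·ρ₁^{k−j}·τ^{K−j}`) from the slices of the family's live generations and
the booking's envelope.  Observation: the slice size of generation `(b, k′)` at step `k` is `gen b k′ × ∏_{[k′,k)} e^{3(s⁰+s₁)}`
(§15 `birthSlice_iterate`), and the capstone's own domination binder has `e^{3(s⁰_i+s₁_i)} ≤ α_i` (`hdom`, window factor `≥ 1`),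
so slice size `≤ gen b k′·stepProd α k′ k`; with the TRANSVERSE fresh defect `c_δψ^{k−k′}` of the generation the family's
response is `≤ (4c_δ/r_*)·Σ_{k′∈[j,k]} gen b k′·stepProd (ψ·α) k′ k = (4c_δ/r_*)·envVar 1 (ψ·α) b k` — THE BOOKING'S ENVELOPE
WITH THE BOOKING'S OWN RATE (`stepProd_mul`, `stepProd_const`).  Hence `envelopeResponse_of_booking`: slice sizes
`≤ gen·stepProd α` (under the budget history), transverse defects, radius floor, and the booking's `EnvBoundAtVar 1 (ψ·α) σ k` at
every `k < K` with a class `σ j k ≤ A₀·ρ₁^{k−j}·τ^{K−j}` (the `prodRate` classes of `sizeBound_gates_prodRate` have this form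
with `ρ₁ ≥ ψα_i + C·c_i`) ⟹ `EnvelopeResponse … (4c_δ/r_*·A₀) ρ₁ τ K`; and `perStep_budget_of_booking`: + positional count
+ the fresh budget + per-step action margin + `Λ·ρ₁·τ ≤ ρ < 1` + the K-FREE smallness `c·N₀·(4c_δA₀/r_*)·(1−ρ)⁻¹ ≤ 1 − s̄⁰` ⟹
for every `k < K` the capstone's budget `s⁰ k + s₁ k ≤ 1` (`perStep_budget_of_envelope` by name).  WHAT REMAINS (stated, not
hidden): the booking's envelope bound at scale `k` and the capstone's budget at scale `k` feed EACH OTHER one scale later — the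
cumulative-gate architecture of `T4TrajectoryComparison` §10 (`envBoundAtVar_ranBelow`, gates discharged scale by scale)
resolves exactly this kind of loop; instantiating it with the dressed data is the assembling seat's plumbing, not done here.
-/

namespace Summit.QuantumFields.BalabanUV.T4Continuum.T4TrajectoryDensityDressed

open Literature.MathematicalPhysics.QuantumFieldTheory.Balaban1983to89
open T4TermFormat T4TrajectoryComparison

noncomputable section

section BookingLink

open Finset

variable {B : Booking} {T : Trajectory B}

/-- The booking's transport-rate step product splits off the geometric part: `stepProd (ψ·α) k′ k = ψ^{k−k′}·stepProd α k′ k`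
(`stepProd_mul`, `stepProd_const`). [folklore] -/
theorem stepProd_psi_mul (ψ : ℝ) (α : ℕ → ℝ) (k' k : ℕ) :
    stepProd (fun i => ψ * α i) k' k = ψ ^ (k - k') * stepProd α k' k := by
  rw [stepProd_mul (fun _ => ψ) α k' k, stepProd_const]

/-- **THE ENVELOPE RESPONSE READ OFF THE BOOKING.**  For every step `k < K` under the budget history and every live family
`b ∈ S k` (birth scale `j ≤ k`): slice sizes of its live generations `A b k′ k ≤ gen b k′·stepProd α k′ k` (§15 × the capstone's
`e^{3(s⁰+s₁)} ≤ α`), TRANSVERSE fresh defects `0 ≤ δ b k′ k ≤ c_δ·ψ^{k−k′}`, a radius floor `r_* > 0`, the family response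
`resp k b ≤ Σ_{k′∈[j,k]} 4·A b k′ k / r_*·δ b k′ k`, the booking's envelope bound `EnvBoundAtVar 1 (ψ·α) σ k` and a constant-rate
class `σ j k ≤ A₀·ρ₁^{k−j}·τ^{K−j}` ⟹ `EnvelopeResponse resp s⁰ s₁ S birthScale (4c_δ/r_*·A₀) ρ₁ τ K`. [folklore] -/
theorem envelopeResponse_of_booking {A δ : B.Birth → ℕ → ℕ → ℝ} {resp : ℕ → B.Birth → ℝ} {s₀ s₁ : ℕ → ℝ}
    {S : ℕ → Finset B.Birth} {α : ℕ → ℝ} {σ : ℕ → ℕ → ℝ} {cδ ψ rstar A₀ ρ₁ τ : ℝ} {K : ℕ}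
    (hcδ : 0 ≤ cδ) (hrstar : 0 < rstar) (hα : ∀ i, 0 ≤ α i)
    (hS : ∀ k, ∀ b ∈ S k, B.birthScale b ≤ k)
    (hA : ∀ k < K, (∀ i < k, s₀ i + s₁ i ≤ 1) → ∀ b ∈ S k, ∀ k', B.birthScale b ≤ k' → k' ≤ k →
      A b k' k ≤ T.gen b k' * stepProd α k' k)
    (hδ : ∀ k, ∀ b ∈ S k, ∀ k', B.birthScale b ≤ k' → k' ≤ k → 0 ≤ δ b k' k ∧ δ b k' k ≤ cδ * ψ ^ (k - k'))
    (hresp : ∀ k, ∀ b ∈ S k, resp k b ≤ ∑ k' ∈ Icc (B.birthScale b) k, 4 * A b k' k / rstar * δ b k' k)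
    (henv : ∀ k < K, T.EnvBoundAtVar 1 (fun i => ψ * α i) σ k)
    (hσ : ∀ j k, j ≤ k → k < K → σ j k ≤ A₀ * ρ₁ ^ (k - j) * τ ^ (K - j)) :
    EnvelopeResponse resp s₀ s₁ S B.birthScale (4 * cδ / rstar * A₀) ρ₁ τ K := by
  intro k hk hbud b hb
  have hjk : B.birthScale b ≤ k := hS k b hb
  -- generation by generation
  have hterm : ∀ k' ∈ Icc (B.birthScale b) k,
      4 * A b k' k / rstar * δ b k' k ≤ 4 * cδ / rstar * (1 * stepProd (fun i => ψ * α i) k' k * T.gen b k') := by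
    intro k' hk'
    obtain ⟨h1, h2⟩ := mem_Icc.mp hk'
    have hsp : 0 ≤ stepProd α k' k := stepProd_nonneg hα k' k
    have hgen : 0 ≤ T.gen b k' := T.gen_nonneg b k'
    have hAle : A b k' k ≤ T.gen b k' * stepProd α k' k := hA k hk hbud b hb k' h1 h2
    have hM : 0 ≤ 4 * (T.gen b k' * stepProd α k' k) / rstar := by positivity
    calc 4 * A b k' k / rstar * δ b k' k ≤ 4 * (T.gen b k' * stepProd α k' k) / rstar * δ b k' k :=
          mul_le_mul_of_nonneg_right (div_le_div_of_nonneg_right (by linarith) hrstar.le) (hδ k b hb k' h1 h2).1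
      _ ≤ 4 * (T.gen b k' * stepProd α k' k) / rstar * (cδ * ψ ^ (k - k')) :=
          mul_le_mul_of_nonneg_left (hδ k b hb k' h1 h2).2 hM
      _ = 4 * cδ / rstar * (1 * stepProd (fun i => ψ * α i) k' k * T.gen b k') := by
          rw [stepProd_psi_mul]
          ring
  have henvb : T.envVar 1 (fun i => ψ * α i) b k ≤ σ (B.birthScale b) k := henv k hk b hjk
  have hC : 0 ≤ 4 * cδ / rstar := by positivity
  calc resp k b ≤ ∑ k' ∈ Icc (B.birthScale b) k, 4 * A b k' k / rstar * δ b k' k := hresp k b hb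
    _ ≤ ∑ k' ∈ Icc (B.birthScale b) k, 4 * cδ / rstar * (1 * stepProd (fun i => ψ * α i) k' k * T.gen b k') :=
        sum_le_sum hterm
    _ = 4 * cδ / rstar * T.envVar 1 (fun i => ψ * α i) b k := by
        rw [Trajectory.envVar, mul_sum]
    _ ≤ 4 * cδ / rstar * (A₀ * ρ₁ ^ (k - B.birthScale b) * τ ^ (K - B.birthScale b)) :=
        mul_le_mul_of_nonneg_left (henvb.trans (hσ _ _ hjk hk)) hC
    _ = 4 * cδ / rstar * A₀ * ρ₁ ^ (k - B.birthScale b) * τ ^ (K - B.birthScale b) := by ring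

/-- **THE PER-STEP BUDGET READ OFF THE BOOKING** (`perStep_budget_of_envelope` by name): the data of
`envelopeResponse_of_booking` + the positional count `#{b ∈ S k : birthScale b = j} ≤ N₀Λ^{k−j}` + the fresh supplier's budget
`s₁ k ≤ c·Σ_{b∈S k} resp k b` + a per-step action margin `s⁰ k ≤ s̄⁰` + the strict product at the family rate `Λ·ρ₁·τ ≤ ρ < 1`
(`0 ≤ τ ≤ 1`, `0 ≤ A₀`) + the K-FREE smallness `c·(N₀·(4c_δ/r_*·A₀)·1·(1−ρ)⁻¹) ≤ 1 − s̄⁰` ⟹ for every `k < K`: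
`s⁰ k + s₁ k ≤ 1` and `s₁ k ≤ c·(N₀·(4c_δ/r_*·A₀)·1·(1−ρ)⁻¹)·τ^{K−k}`. [folklore] -/
theorem perStep_budget_of_booking {A δ : B.Birth → ℕ → ℕ → ℝ} {resp : ℕ → B.Birth → ℝ} {s₀ s₁ : ℕ → ℝ}
    {S : ℕ → Finset B.Birth} {α : ℕ → ℝ} {σ : ℕ → ℕ → ℝ} {c cδ ψ rstar A₀ ρ₁ τ N₀ Λ ρ sbar : ℝ} {K : ℕ}
    (hc : 0 ≤ c) (hcδ : 0 ≤ cδ) (hrstar : 0 < rstar) (hA₀ : 0 ≤ A₀) (hα : ∀ i, 0 ≤ α i) (hN₀ : 0 ≤ N₀)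
    (hΛ : 0 ≤ Λ) (hρ₁ : 0 ≤ ρ₁) (hτ0 : 0 ≤ τ) (hτ1 : τ ≤ 1) (hρlt : ρ < 1) (hprod : Λ * ρ₁ * τ ≤ ρ)
    (hs₀ : ∀ k, s₀ k ≤ sbar)
    (hS : ∀ k, ∀ b ∈ S k, B.birthScale b ≤ k)
    (hA : ∀ k < K, (∀ i < k, s₀ i + s₁ i ≤ 1) → ∀ b ∈ S k, ∀ k', B.birthScale b ≤ k' → k' ≤ k →
      A b k' k ≤ T.gen b k' * stepProd α k' k)
    (hδ : ∀ k, ∀ b ∈ S k, ∀ k', B.birthScale b ≤ k' → k' ≤ k → 0 ≤ δ b k' k ∧ δ b k' k ≤ cδ * ψ ^ (k - k'))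
    (hresp : ∀ k, ∀ b ∈ S k, resp k b ≤ ∑ k' ∈ Icc (B.birthScale b) k, 4 * A b k' k / rstar * δ b k' k)
    (henv : ∀ k < K, T.EnvBoundAtVar 1 (fun i => ψ * α i) σ k)
    (hσ : ∀ j k, j ≤ k → k < K → σ j k ≤ A₀ * ρ₁ ^ (k - j) * τ ^ (K - j))
    (hcount : ∀ k, ∀ j ≤ k, (((S k).filter fun b => B.birthScale b = j).card : ℝ) ≤ N₀ * Λ ^ (k - j))
    (hs₁ : ∀ k < K, s₁ k ≤ c * ∑ b ∈ S k, resp k b)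
    (hsmall : c * (N₀ * (4 * cδ / rstar * A₀) * 1 * (1 - ρ)⁻¹) ≤ 1 - sbar) :
    ∀ k < K, s₀ k + s₁ k ≤ 1 ∧ s₁ k ≤ c * (N₀ * (4 * cδ / rstar * A₀) * 1 * (1 - ρ)⁻¹) * τ ^ (K - k) :=
  perStep_budget_of_envelope hc hN₀ (by positivity) hΛ hρ₁ hτ0 hτ1 hρlt hprod hs₀ hS
    (envelopeResponse_of_booking hcδ hrstar hα hS hA hδ hresp henv hσ) hcount hs₁ hsmall

end BookingLink

end

end Summit.QuantumFields.BalabanUV.T4Continuum.T4TrajectoryDensityDressed
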